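import Literature.AnabelianGeometry.SemiGraphs.StableReductionTowerGaloisNonVacuity
import Summits.ABC.IUTFork.MLFGaloisTFG
import HarnessLib

/-!
# [SemiAnbd] Example 5.6: `StableReductionTower` with genuine infinite arithmetic components over `G_{ℚ_p}` —
# UNCONDITIONAL (Summits-side assembly)

Cell `abc-iut` (run/shared/lean/pub/abc-iut/), layer L3 NV lane, seat abc-iut-w6-d108 (row
«NV-L3 StableReductionTower-GQp»).  PROOF-ONLY (no `def`, no `instance`, no named fact).  The Literature file
`StableReductionTowerGaloisNonVacuity.lean` inhabits abc-iut-L3-t3's record `StableReductionTower` of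
[SemiAnbd] Example 5.6 [cite: MochizukiSemiAnbd2006, Ex 5.6, p. 67] over the arithmetic datum `Π := G_{ℚ_p}`
(`aug = id`, `Δ = 1`) with `M_i := charOpenCore G_{ℚ_p} i` and levels whose arithmetic components are
`π̂₁(A_i) ≅ M_i` (infinite, open of finite index, characteristic, exhaustive), GIVEN Def 5.1 (i)(a)
"`G_{ℚ_p}` topologically finitely generated" (or modulo the named fact `localEulerPoincareCharacteristic`).
Here that hypothesis is DISCHARGED by abc-iut-L4-d1's
`Summit.ABC.IUTFork.isTopologicallyFinitelyGenerated_absoluteGaloisGroup_padic` (p421667; GAP row G-L4t4-2).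

HONEST LABEL: genuine ARITHMETIC, NO GEOMETRY (`Δ = 1`; one-vertex edgeless levels with the trivial action;
decomposition representatives `⊤`): the arithmetic half of Example 5.6 realised with the cell's typed objects,
NOT the stable-reduction tower of a curve; no `StableReductionOrigin` certificate is issued.  Nothing here
asserts anything about abc or takes a side on [IUTchIII] Cor. 3.12; instantiated ≠ endorsed.
-/

noncomputable section

namespace Summit.ABC.IUTFork

open _root_.CategoryTheory Field
open Literature.AnabelianGeometry.SemiGraphs
open Literature.AnabelianGeometry.SemiGraphs.SgAQuot

/-- **`StableReductionTower (SemiAnbdVocab.ofReal R) D` over `Π := G_{ℚ_p}`, UNCONDITIONALLY**: for every prime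
`p` and every bridge residual `R` there are `D : TemperedArithmeticGroup ℚ_[p]` with `D.Pi ≃ₜ* G_{ℚ_p}` along
`aug` (`Δ = 1`) and a tower `T` with `T.M i = charOpenCore D.Pi i`, `(T.arithEmb i).range = aug(M_i)`,
trivial admissible kernels and INFINITE arithmetic components `π̂₁(A_i)`.
[cite: MochizukiSemiAnbd2006, Ex 5.6, p. 67] -/
theorem stableReductionTower_exists_galoisQp (R : SgA.BridgeResidual.{0, 1, 0}) (p : ℕ) [Fact p.Prime] :
    ∃ (D : TemperedArithmeticGroup ℚ_[p]) (e : D.Pi ≃ₜ* absoluteGaloisGroup ℚ_[p])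
      (T : StableReductionTower (SemiAnbdVocab.ofReal R) D),
      (∀ g, D.aug g = e g) ∧ D.delta = ⊥ ∧
      (∀ i, T.M i = charOpenCore D.Pi i) ∧ (∀ i, (T.arithEmb i).range = (T.M i).map D.aug.toMonoidHom) ∧
      (∀ i, T.admKer i = ⊥) ∧ (∀ i, Infinite (T.𝔊 i).PA) :=
  StableReductionTower.exists_galoisQp_of_tfg R p (isTopologicallyFinitelyGenerated_absoluteGaloisGroup_padic p ℚ_[p])

/-- The census form at abc-iut-w4-d082's degenerate bridge residual: `StableReductionTower` is inhabited over a
`D` with `Π = G_{ℚ_p}` — no hypothesis left. [cite: MochizukiSemiAnbd2006, Ex 5.6, p. 67] -/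
theorem stableReductionTower_nonempty_galoisQp (p : ℕ) [Fact p.Prime] :
    ∃ D : TemperedArithmeticGroup ℚ_[p], Nonempty (D.Pi ≃ₜ* absoluteGaloisGroup ℚ_[p]) ∧
      Nonempty (StableReductionTower (SemiAnbdVocab.ofReal SgA.BridgeResidual.trivial.{0, 1, 0}) D) := by
  obtain ⟨D, e, T, -⟩ := stableReductionTower_exists_galoisQp SgA.BridgeResidual.trivial.{0, 1, 0} p
  exact ⟨D, ⟨e⟩, ⟨T⟩⟩

end Summit.ABC.IUTFork

end
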